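import Literature.Probability.LatticeModels.CMTP2DensityFree
import Summits.CriticalPhenomena.PercolationContinuityZ3.Theorems.SahiBoxTP2Real

/-!
# Density-free cMTP₂ (Fuchs–Wang 2026, (5.1)): the elementary theory on a product of measurable lattices

Support file of the Sahi cell (`prim-sahi`, typer seat, generation 18; `--supports stmt-CriticalPhenomena-4575`).
Theorems only (no definitions, no named facts, no sorries).

Fuchs–Wang (arXiv:2607.24394, §5) propose the density-free notion `cMTP₂^set(X_B|X_A)` — the tree's
`Literature.Probability.LatticeModels.IsCMTP2Set μ` for the law `μ` of `(X_A, X_B)` on `X × Y` — and prove nothing about it.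
Here is its elementary theory, i.e. the density-free counterparts of their §2 for the density notion (1.2) (all of
which they prove through densities and their Lemma A.1); density-free, each is a one-line lattice inclusion:

* `prod_Iic_infs_subset` / `prod_Iic_sups_subset` — the events `{X_A ∈ C, X_B ≤ x}` form a lattice of sets:
  `(C × (−∞,x]) ∧ (D × (−∞,y]) ⊆ (C ∧ D) × (−∞,x ∧ y]`, dually for `∨`.
* `isCMTP2Set_of_mIsSetTP2` — Colangelo–Müller–Scarsini's density-free MTP₂ (Def. 2, `mIsSetTP2`) implies (5.1) for
  every split (density-free form of Thm. 2.5 (1) "dMTP₂ ⇒ cMTP₂").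
* `isCMTP2Box_of_isCMTP2Set` — (5.1) ⇒ its box form.
* `isCdfMTP2_of_isCMTP2Set` — (5.1) ⇒ MTP₂ of the distribution function (Thm. 2.5 (2) "cMTP₂ ⇒ MTP₂").
* `isLTD_of_isCdfMTP2`, `isLTD_of_isCMTP2Set` — MTP₂ of the distribution function ⇒ LTD (Cor. 2.12 (1)), hence
  (5.1) ⇒ LTD (Thm. 2.8 (2)), whenever the second block has a cofinal sequence (`ℝ^B`: `exists_cofinal_seq_pi_real`;
  or a top element).
* `isCMTP2Set_prod` and the converses `mIsSetTP2_of_isCMTP2Set_prod`, `isCdfMTP2_of_isCMTP2Set_prod` — for INDEPENDENT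
  blocks, `μ_A ⊗ μ_B` satisfies (5.1) iff `μ_A` is density-free MTP₂ and `μ_B` has an MTP₂ distribution function
  (density-free form of "independence ⇒ cMTP₂", Remark 2.1 (3) / §3, sharpened to a characterisation).

No sorries, no new axioms.  References: [FuchsWang2026] §§2, 5; [ColangeloMullerScarsini2006] Def. 2.
-/

noncomputable section

namespace Summit.CriticalPhenomena.PercolationContinuityZ3.Theorems.SahiCMTP2

open MeasureTheory Set Filter Topology Function
open Literature.Probability.LatticeModels Literature.Probability.LatticeModels.Affiliation
open scoped ENNReal SetFamily

section SetLattice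

variable {X Y : Type*} [Lattice X] [Lattice Y]

/-- **Meets of conditional-orthant events**: `(C × (−∞,x]) ∧ (D × (−∞,y]) ⊆ (C ∧ D) × (−∞, x ∧ y]`. [this work] -/
theorem prod_Iic_infs_subset (C D : Set X) (x y : Y) :
    (C ×ˢ Iic x) ⊼ (D ×ˢ Iic y) ⊆ (C ⊼ D) ×ˢ Iic (x ⊓ y) := by
  rintro _ ⟨p, hp, q, hq, rfl⟩
  exact ⟨Set.mem_infs.2 ⟨p.1, hp.1, q.1, hq.1, rfl⟩, inf_le_inf hp.2 hq.2⟩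

/-- **Joins of conditional-orthant events**: `(C × (−∞,x]) ∨ (D × (−∞,y]) ⊆ (C ∨ D) × (−∞, x ∨ y]`. [this work] -/
theorem prod_Iic_sups_subset (C D : Set X) (x y : Y) :
    (C ×ˢ Iic x) ⊻ (D ×ˢ Iic y) ⊆ (C ⊻ D) ×ˢ Iic (x ⊔ y) := by
  rintro _ ⟨p, hp, q, hq, rfl⟩
  exact ⟨Set.mem_sups.2 ⟨p.1, hp.1, q.1, hq.1, rfl⟩, sup_le_sup hp.2 hq.2⟩

/-- The meets are exact: `(C × (−∞,x]) ∧ (D × (−∞,y]) = (C ∧ D) × (−∞, x ∧ y]` (take `(c, v) ∧ (d, v)` for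
`v ≤ x ∧ y`). [this work] -/
theorem prod_Iic_infs_eq (C D : Set X) (x y : Y) :
    (C ×ˢ Iic x) ⊼ (D ×ˢ Iic y) = (C ⊼ D) ×ˢ Iic (x ⊓ y) := by
  refine (prod_Iic_infs_subset C D x y).antisymm ?_
  rintro ⟨w, v⟩ ⟨hw, hv⟩
  obtain ⟨c, hc, d, hd, hcd⟩ := Set.mem_infs.1 hw
  refine Set.mem_infs.2 ⟨(c, v), ⟨hc, ?_⟩, (d, v), ⟨hd, ?_⟩, ?_⟩
  · exact le_trans (show v ≤ x ⊓ y from hv) inf_le_left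
  · exact le_trans (show v ≤ x ⊓ y from hv) inf_le_right
  · exact Prod.ext hcd (inf_idem v)

/-- The joins are exact when the second factor is distributive:
`(C × (−∞,x]) ∨ (D × (−∞,y]) = (C ∨ D) × (−∞, x ∨ y]` (write `v ≤ x ∨ y` as `v = (v ∧ x) ∨ (v ∧ y)`). [this work] -/
theorem prod_Iic_sups_eq {Y' : Type*} [DistribLattice Y'] (C D : Set X) (x y : Y') :
    (C ×ˢ Iic x) ⊻ (D ×ˢ Iic y) = (C ⊻ D) ×ˢ Iic (x ⊔ y) := by
  refine (prod_Iic_sups_subset C D x y).antisymm ?_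
  rintro ⟨w, v⟩ ⟨hw, hv⟩
  obtain ⟨c, hc, d, hd, hcd⟩ := Set.mem_sups.1 hw
  refine Set.mem_sups.2 ⟨(c, v ⊓ x), ⟨hc, ?_⟩, (d, v ⊓ y), ⟨hd, ?_⟩, ?_⟩
  · exact inf_le_right
  · exact inf_le_right
  · refine Prod.ext hcd ?_
    show (v ⊓ x) ⊔ (v ⊓ y) = v
    rw [← inf_sup_left, inf_eq_left]
    exact hv

end SetLattice

section Lattice

variable {X Y : Type*} [MeasurableSpace X] [MeasurableSpace Y] [Lattice X] [Lattice Y]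

/-- **Density-free MTP₂ ⟹ (5.1)**: a measure satisfying Colangelo–Müller–Scarsini's Definition 2 on `X × Y` satisfies
Fuchs–Wang's `cMTP₂^set` inequality for the split `(X, Y)` — the density-free form of [FuchsWang2026] Thm. 2.5 (1)
(`dMTP₂ ⇒ cMTP₂`), with a one-line proof. [this work] -/
theorem isCMTP2Set_of_mIsSetTP2 [TopologicalSpace Y] [OpensMeasurableSpace Y] [ClosedIicTopology Y]
    {μ : Measure (X × Y)} (hμ : mIsSetTP2 μ) : IsCMTP2Set μ := fun C D hC hD x y =>
  (hμ (hC.prod measurableSet_Iic) (hD.prod measurableSet_Iic)).trans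
    (mul_le_mul' (measure_mono (prod_Iic_infs_subset C D x y)) (measure_mono (prod_Iic_sups_subset C D x y)))

/-- **(5.1) ⟹ its box form** (closed order intervals are measurable and `[a,b] ∧ [a',b'] ⊆ [a ∧ a', b ∧ b']`,
`[a,b] ∨ [a',b'] ⊆ [a ∨ a', b ∨ b']`). [this work] -/
theorem isCMTP2Box_of_isCMTP2Set [TopologicalSpace X] [OpensMeasurableSpace X] [OrderClosedTopology X]
    {μ : Measure (X × Y)} (h : IsCMTP2Set μ) : IsCMTP2Box μ := by
  intro a b a' b' x y
  have h1 : Icc a b ⊼ Icc a' b' ⊆ Icc (a ⊓ a') (b ⊓ b') :=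
    Set.infs_subset_iff.2 fun u hu v hv => ⟨inf_le_inf hu.1 hv.1, inf_le_inf hu.2 hv.2⟩
  have h2 : Icc a b ⊻ Icc a' b' ⊆ Icc (a ⊔ a') (b ⊔ b') :=
    Set.sups_subset_iff.2 fun u hu v hv => ⟨sup_le_sup hu.1 hv.1, sup_le_sup hu.2 hv.2⟩
  exact (h measurableSet_Icc measurableSet_Icc x y).trans
    (mul_le_mul' (measure_mono (prod_mono h1 Subset.rfl)) (measure_mono (prod_mono h2 Subset.rfl)))

/-- **(5.1) ⟹ MTP₂ of the distribution function** (density-free [FuchsWang2026] Thm. 2.5 (2), `cMTP₂ ⇒ MTP₂`):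
lower orthants of `X × Y` are the conditional-orthant events with `C = (−∞, x_A]`. [this work] -/
theorem isCdfMTP2_of_isCMTP2Set [TopologicalSpace X] [OpensMeasurableSpace X] [ClosedIicTopology X]
    {μ : Measure (X × Y)} (h : IsCMTP2Set μ) : IsCdfMTP2 μ := by
  intro p q
  rw [Iic_prod_eq p, Iic_prod_eq q, Iic_prod_eq (p ⊓ q), Iic_prod_eq (p ⊔ q)]
  have h1 : Iic p.1 ⊼ Iic q.1 ⊆ Iic (p.1 ⊓ q.1) := Set.infs_subset_iff.2 fun u hu v hv => inf_le_inf hu hv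
  have h2 : Iic p.1 ⊻ Iic q.1 ⊆ Iic (p.1 ⊔ q.1) := Set.sups_subset_iff.2 fun u hu v hv => sup_le_sup hu hv
  exact (h measurableSet_Iic measurableSet_Iic p.2 q.2).trans
    (mul_le_mul' (measure_mono (prod_mono h1 Subset.rfl)) (measure_mono (prod_mono h2 Subset.rfl)))

/-- **MTP₂ of the distribution function ⟹ LTD** (density-free [FuchsWang2026] Cor. 2.12 (1) / proof of Thm. 2.8 (2)):
apply the orthant inequality to `(x_A, s_n)` and `(y_A, x_B)` and let the cofinal sequence `s_n ↑` exhaust the second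
block. [this work] -/
theorem isLTD_of_isCdfMTP2 {μ : Measure (X × Y)} (h : IsCdfMTP2 μ) {s : ℕ → Y} (hs : Monotone s)
    (hcof : ∀ y, ∃ n, y ≤ s n) : IsLTD μ := by
  intro xA yA hle xB
  rw [mul_comm]
  have hU : (Iic xA : Set X) ×ˢ (univ : Set Y) = ⋃ n, (Iic xA : Set X) ×ˢ Iic (s n) := by
    rw [← Set.prod_iUnion]
    congr 1
    ext y
    simp only [mem_univ, mem_iUnion, mem_Iic, true_iff]
    exact hcof y
  have hmono : Monotone fun n => (Iic xA : Set X) ×ˢ Iic (s n) :=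
    fun m n hmn => prod_mono Subset.rfl (Iic_subset_Iic.2 (hs hmn))
  rw [hU, hmono.measure_iUnion, ENNReal.iSup_mul]
  refine iSup_le fun n => ?_
  have key := h (xA, s n) (yA, xB)
  rw [Iic_prod_eq, Iic_prod_eq, Iic_prod_eq, Iic_prod_eq] at key
  refine key.trans (mul_le_mul' (measure_mono (prod_mono ?_ ?_)) (measure_mono (prod_mono ?_ (subset_univ _))))
  · exact Iic_subset_Iic.2 inf_le_left
  · exact Iic_subset_Iic.2 inf_le_right
  · exact Iic_subset_Iic.2 (sup_le hle le_rfl)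

/-- With a top element the cofinal sequence is constant. [this work] -/
theorem isLTD_of_isCdfMTP2_of_orderTop [OrderTop Y] {μ : Measure (X × Y)} (h : IsCdfMTP2 μ) : IsLTD μ :=
  isLTD_of_isCdfMTP2 h (s := fun _ => ⊤) (fun _ _ _ => le_rfl) fun _ => ⟨0, le_top⟩

/-- **(5.1) ⟹ LTD** (density-free [FuchsWang2026] Thm. 2.8 (2)), given a cofinal sequence of the second block.
[this work] -/
theorem isLTD_of_isCMTP2Set [TopologicalSpace X] [OpensMeasurableSpace X] [ClosedIicTopology X]
    {μ : Measure (X × Y)} (h : IsCMTP2Set μ) {s : ℕ → Y} (hs : Monotone s) (hcof : ∀ y, ∃ n, y ≤ s n) :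
    IsLTD μ :=
  isLTD_of_isCdfMTP2 (isCdfMTP2_of_isCMTP2Set h) hs hcof

/-! ### Independent blocks -/

/-- **Independent blocks: set-TP₂ ⊗ cdf-MTP₂ ⟹ (5.1).**  If `μ_A` satisfies Definition 2 and `μ_B` has an MTP₂
distribution function, then `μ_A ⊗ μ_B` satisfies `cMTP₂^set(X_B|X_A)`:
`μ_A(C)μ_A(D)·F(x)F(y) ≤ μ_A(C ∧ D)μ_A(C ∨ D)·F(x ∧ y)F(x ∨ y)` (density-free form of "independence ⇒ cMTP₂",
[FuchsWang2026] Remark 2.1 (3) / §3). [this work] -/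
theorem isCMTP2Set_prod {μ₁ : Measure X} {μ₂ : Measure Y} [SFinite μ₂] (h₁ : mIsSetTP2 μ₁) (h₂ : IsCdfMTP2 μ₂) :
    IsCMTP2Set (μ₁.prod μ₂) := by
  intro C D hC hD x y
  simp only [Measure.prod_prod]
  calc μ₁ C * μ₂ (Iic x) * (μ₁ D * μ₂ (Iic y)) = (μ₁ C * μ₁ D) * (μ₂ (Iic x) * μ₂ (Iic y)) := mul_mul_mul_comm _ _ _ _
    _ ≤ (μ₁ (C ⊼ D) * μ₁ (C ⊻ D)) * (μ₂ (Iic (x ⊓ y)) * μ₂ (Iic (x ⊔ y))) := mul_le_mul' (h₁ hC hD) (h₂ x y)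
    _ = μ₁ (C ⊼ D) * μ₂ (Iic (x ⊓ y)) * (μ₁ (C ⊻ D) * μ₂ (Iic (x ⊔ y))) := mul_mul_mul_comm _ _ _ _

/-- **Converse, first block**: if `μ_A ⊗ μ_B` satisfies (5.1) and some orthant of the second block has positive finite
mass, then `μ_A` satisfies Definition 2. [this work] -/
theorem mIsSetTP2_of_isCMTP2Set_prod {μ₁ : Measure X} {μ₂ : Measure Y} [SFinite μ₂] (h : IsCMTP2Set (μ₁.prod μ₂))
    {y : Y} (hy0 : μ₂ (Iic y) ≠ 0) (hytop : μ₂ (Iic y) ≠ ∞) : mIsSetTP2 μ₁ := by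
  intro C D hC hD
  have key := h hC hD y y
  simp only [Measure.prod_prod, inf_idem, sup_idem] at key
  have h2 : μ₂ (Iic y) * μ₂ (Iic y) ≠ 0 := mul_ne_zero hy0 hy0
  have h2' : μ₂ (Iic y) * μ₂ (Iic y) ≠ ∞ := ENNReal.mul_ne_top hytop hytop
  refine (ENNReal.mul_le_mul_iff_left h2 h2').1 ?_
  calc μ₁ C * μ₁ D * (μ₂ (Iic y) * μ₂ (Iic y)) = μ₁ C * μ₂ (Iic y) * (μ₁ D * μ₂ (Iic y)) :=
        mul_mul_mul_comm _ _ _ _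
    _ ≤ μ₁ (C ⊼ D) * μ₂ (Iic y) * (μ₁ (C ⊻ D) * μ₂ (Iic y)) := key
    _ = μ₁ (C ⊼ D) * μ₁ (C ⊻ D) * (μ₂ (Iic y) * μ₂ (Iic y)) := mul_mul_mul_comm _ _ _ _

/-- **Converse, second block**: if `μ_A ⊗ μ_B` satisfies (5.1) and `μ_A` is a nonzero finite measure, then `μ_B` has
an MTP₂ distribution function. [this work] -/
theorem isCdfMTP2_of_isCMTP2Set_prod {μ₁ : Measure X} {μ₂ : Measure Y} [SFinite μ₂] [IsFiniteMeasure μ₁]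
    [NeZero μ₁] (h : IsCMTP2Set (μ₁.prod μ₂)) : IsCdfMTP2 μ₂ := by
  intro x y
  have key := h MeasurableSet.univ MeasurableSet.univ x y
  have hu : (univ : Set X) ⊼ univ = univ :=
    Set.eq_univ_of_forall fun a => Set.mem_infs.2 ⟨a, trivial, a, trivial, inf_idem a⟩
  have hu' : (univ : Set X) ⊻ univ = univ :=
    Set.eq_univ_of_forall fun a => Set.mem_sups.2 ⟨a, trivial, a, trivial, sup_idem a⟩
  simp only [Measure.prod_prod, hu, hu'] at key
  have h1 : μ₁ univ * μ₁ univ ≠ 0 := mul_ne_zero (NeZero.ne _) (NeZero.ne _)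
  have h1' : μ₁ univ * μ₁ univ ≠ ∞ := ENNReal.mul_ne_top (measure_ne_top _ _) (measure_ne_top _ _)
  refine (ENNReal.mul_le_mul_iff_right h1 h1').1 ?_
  calc μ₁ univ * μ₁ univ * (μ₂ (Iic x) * μ₂ (Iic y)) = μ₁ univ * μ₂ (Iic x) * (μ₁ univ * μ₂ (Iic y)) :=
        mul_mul_mul_comm _ _ _ _
    _ ≤ μ₁ univ * μ₂ (Iic (x ⊓ y)) * (μ₁ univ * μ₂ (Iic (x ⊔ y))) := key
    _ = μ₁ univ * μ₁ univ * (μ₂ (Iic (x ⊓ y)) * μ₂ (Iic (x ⊔ y))) := mul_mul_mul_comm _ _ _ _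

end Lattice

/-! ### Cofinal sequences of `ℝ^B` -/

/-- `ℝ^B` (`B` finite) has the cofinal increasing sequence `n ↦ (n,…,n)`. [folklore] -/
theorem exists_cofinal_seq_pi_real {κ : Type*} [Finite κ] :
    ∃ s : ℕ → κ → ℝ, Monotone s ∧ ∀ y : κ → ℝ, ∃ n, y ≤ s n := by
  refine ⟨fun n _ => n, fun m n hmn _ => Nat.cast_le.2 hmn, fun y => ?_⟩
  obtain ⟨M, hM⟩ := (Set.finite_range y).bddAbove
  obtain ⟨n, hn⟩ := exists_nat_ge M
  exact ⟨n, fun i => (hM ⟨i, rfl⟩).trans hn⟩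

/-- **(5.1) ⟹ LTD on `X × ℝ^B`.** [this work] -/
theorem isLTD_of_isCMTP2Set_pi_real {X κ : Type*} [MeasurableSpace X] [Lattice X] [TopologicalSpace X]
    [OpensMeasurableSpace X] [ClosedIicTopology X] [Finite κ] {μ : Measure (X × (κ → ℝ))} (h : IsCMTP2Set μ) :
    IsLTD μ := by
  obtain ⟨s, hs, hcof⟩ := exists_cofinal_seq_pi_real (κ := κ)
  exact isLTD_of_isCMTP2Set h hs hcof

end Summit.CriticalPhenomena.PercolationContinuityZ3.Theorems.SahiCMTP2
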